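import Mathlib
import Summits.ValiantsHypothesis.ValiantsHypothesis.Theorems.LiouvilleSarnakAlignedTypeICharactersMod2nBilinearSieveVariance
import Summits.ValiantsHypothesis.ValiantsHypothesis.Theorems.LiouvilleSarnakAlignedTypeICharactersMod2nBilinearSieveBlocks
import Summits.ValiantsHypothesis.ValiantsHypothesis.Theorems.LiouvilleSarnakAlignedTypeICharactersMod2nBilinearSieveScalars
import HarnessLib

/-!
# Route LiouvilleSarnak — support `AlignedTypeI` (stmt-ValiantsHypothesis-21040), line `characters_mod_2n`:
# assembly — `AlignedTypeI` from PRIME character sums to `2`-power moduli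

The bilinear inequality (`charSqSum_mul_sq_le_of_blockBounds'`), the block bridges (`norm_sum_fibre_le_of_primeSums`), the
binary-rounding block map (`exists_binaryRound`) and the tree's Mertens tail bound
(`MertensBound.loglog_sub_loglog_le_sum_inv_prime`) assembled: the character mean square of the leaf,
`Σ_{ψ ≠ 1 (mod 2^k)} |Σ_{m ≤ 2^(n+k)} λ(m)ψ(m)|² ≤ ε · 4^(n+k)` (`k₀ ≤ k ≤ n`, `n ≥ n₀`), hence `AlignedTypeI`
(via `alignedTypeI_of_charMeanSquare` with `χ₁ = 1`), follows from ONE statement about prime sums — spelled out as the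
hypothesis (no definition):

  (PCS)  for all `θ > 0`, `η > 0` there is `k₁` such that for `k ≥ k₁`, every non-principal `ψ (mod 2^k)`, every
         `a ≥ θk` and every `u ≥ 2^a`:  `|Σ_{p ≤ u, p prime} ψ(p)| ≤ η · u / log u`.

(PCS) is the content of Banks–Shparlinski, TAMS 373 (2020), Thm 2.2 (the `ψ(x,χ)` half, `q = 2^γ`, three ranges; with the
remark after it for imprimitive characters, PNT in progressions mod `8` for the conductors `4, 8`, and partial summation)
— earlier Gallagher, Invent. Math. 16 (1972) —: prime character sums to `2`-power moduli save `o(1)` at every length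
`u ≥ q^θ`.  It is NOT proved here; `alignedTypeI_of_primeCharSums` is CONDITIONAL on it (an arrow, no `def`).

Parameters (for `0 < ε ≤ 1`): `4^s ≥ 72/ε` (`ℓ = x/2^s`), `r` with `r log 2 ≥ 48/ε + 2` and `A = ⌊k/2^(r+2)⌋`, `B = 2^r A`
(`𝒫 = primes in (2^A, 2^B]`, `L ≥ r log 2 − 1` by Mertens, `|𝒫| ≤ 2^B ≤ 2^{k/4}`), `θ = 2^{-(r+3)}`,
`η = ε log 2 / (64 (2^r + 1) 2^s)` (so that `R ≤ (ε/4) L`), and `k₀, n₀` large.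

HONEST FRAMING. A CONDITIONAL closure of the leaf's analytic residual on the prime-sum statement (PCS); (PCS) is a
published theorem but is NOT proved in the tree.  `AlignedTypeI` is NOT closed unconditionally; nothing bears on
`VP ≠ VNP` (NOT proved).
-/

set_option linter.dupNamespace false

noncomputable section

namespace Summit.ValiantsHypothesis.ValiantsHypothesis.Theorems.LiouvilleSarnak.AlignedTypeI.CharactersModTwoN

open ArithmeticFunction Finset
open scoped BigOperators

/-! ## The character mean square, and the crux, from prime character sums -/

/-- **The leaf's character mean square from (PCS).**  See the module docstring. [folklore] -/
theorem charMeanSquare_of_primeCharSums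
    (hPCS : ∀ θ : ℝ, 0 < θ → ∀ η : ℝ, 0 < η → ∃ k₁ : ℕ, ∀ k : ℕ, k₁ ≤ k →
      ∀ ψ : DirichletCharacter ℂ (2 ^ k), ψ ≠ 1 → ∀ a : ℕ, θ * k ≤ a → ∀ u : ℕ, 2 ^ a ≤ u →
        ‖∑ p ∈ (Finset.Iic u).filter Nat.Prime, ψ (p : ZMod (2 ^ k))‖ ≤ η * u / Real.log u) :
    ∀ ε : ℝ, 0 < ε → ∃ k₀ n₀ : ℕ, ∀ n ≥ n₀, ∀ k : ℕ, k₀ ≤ k → k ≤ n →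
      ∃ χ₁ : DirichletCharacter ℂ (2 ^ k),
        ∑ ψ ∈ (Finset.univ : Finset (DirichletCharacter ℂ (2 ^ k))).erase χ₁,
          ‖∑ m : Fin (2 ^ (n + k)), ((ArithmeticFunction.liouville ((m : ℕ) + 1) : ℤ) : ℂ) *
              ψ (((m : ℕ) + 1 : ℕ) : ZMod (2 ^ k))‖ ^ 2 ≤ ε * 4 ^ (n + k) := by
  intro ε₀ hε₀
  -- work with `ε = min ε₀ 1`
  set ε := min ε₀ 1 with hεdef
  have hε : 0 < ε := lt_min hε₀ one_pos
  have hε1 : ε ≤ 1 := min_le_right _ _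
  have hεε₀ : ε ≤ ε₀ := min_le_left _ _
  -- parameters
  obtain ⟨s, hs⟩ : ∃ s : ℕ, 72 / ε < (4 : ℝ) ^ s := pow_unbounded_of_one_lt _ (by norm_num : (1 : ℝ) < 4)
  obtain ⟨r, hr⟩ : ∃ r : ℕ, (48 / ε + 2) / Real.log 2 ≤ r := exists_nat_ge _
  have hlog2 : 0 < Real.log 2 := Real.log_pos (by norm_num)
  have hr' : 48 / ε + 2 ≤ r * Real.log 2 := by rwa [div_le_iff₀ hlog2] at hr
  set θ : ℝ := 1 / (8 * 2 ^ r) with hθ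
  have hθ0 : 0 < θ := by positivity
  set η : ℝ := ε * Real.log 2 / (64 * (2 ^ r + 1) * 2 ^ s) with hη
  have hη0 : 0 < η := by positivity
  obtain ⟨k₁, hk₁⟩ := hPCS θ hθ0 η hη0
  refine ⟨max k₁ (36 * 2 ^ r * (s + 4)), s + 4, fun n hn k hk hkn => ⟨1, ?_⟩⟩
  have hk₁k : k₁ ≤ k := le_trans (le_max_left _ _) hk
  have hkbig : 36 * 2 ^ r * (s + 4) ≤ k := le_trans (le_max_right _ _) hk
  -- the block range `(2^A, 2^B]`
  set A : ℕ := k / (4 * 2 ^ r) with hA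
  set B : ℕ := 2 ^ r * A with hB
  have h2r : 1 ≤ 2 ^ r := Nat.one_le_two_pow
  have hA9 : 9 ≤ A := by
    rw [hA]
    refine (Nat.le_div_iff_mul_le (by positivity)).mpr ?_
    calc 9 * (4 * 2 ^ r) = 36 * 2 ^ r * 1 := by ring
      _ ≤ 36 * 2 ^ r * (s + 4) := Nat.mul_le_mul_left _ (by omega)
      _ ≤ k := hkbig
  have hAs : s + 4 ≤ A := by
    rw [hA]
    refine (Nat.le_div_iff_mul_le (by positivity)).mpr ?_
    calc (s + 4) * (4 * 2 ^ r) ≤ 36 * 2 ^ r * (s + 4) := by nlinarith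
      _ ≤ k := hkbig
  have hAB : A ≤ B := by rw [hB]; exact Nat.le_mul_of_pos_left _ (by positivity)
  have h4B : 4 * B ≤ k := by
    rw [hB, hA]
    calc 4 * (2 ^ r * (k / (4 * 2 ^ r))) = (4 * 2 ^ r) * (k / (4 * 2 ^ r)) := by ring
      _ ≤ k := Nat.mul_div_le k _
  have hθA : θ * k ≤ A := by
    rw [hθ]
    have h1 : (A : ℝ) * ((4 * 2 ^ r : ℕ) : ℝ) + (4 * 2 ^ r : ℕ) > k := by
      have := Nat.lt_div_mul_add (show 0 < 4 * 2 ^ r by positivity) (a := k)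
      rw [← hA] at this
      exact_mod_cast this
    push_cast at h1
    have h2 : (9 : ℝ) ≤ A := by exact_mod_cast hA9
    have h2r' : (1 : ℝ) ≤ 2 ^ r := by exact_mod_cast h2r
    rw [div_mul_eq_mul_div, one_mul, div_le_iff₀ (by positivity)]
    nlinarith
  ------------------------------------------------------------------------------------------------
  -- the modulus, the length, the short parameter
  haveI : NeZero (2 ^ k) := ⟨pow_ne_zero _ two_ne_zero⟩
  have hsn : s + 4 ≤ n := hn
  set x : ℕ := 2 ^ (n + k) with hx
  set ℓ : ℕ := 2 ^ (n + k - s) with hℓ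
  have hxℓ : x = 2 ^ s * ℓ := by
    rw [hx, hℓ, ← pow_add]
    congr 1
    omega
  have hℓx : ℓ ≤ x := by rw [hx, hℓ]; exact Nat.pow_le_pow_right (by norm_num) (by omega)
  have h2qℓ : 2 * 2 ^ k ≤ ℓ := by
    rw [hℓ, ← pow_succ']
    exact Nat.pow_le_pow_right (by norm_num) (by omega)
  have hqB : 2 ^ k * 2 ^ (B + 2) ≤ x := by
    rw [hx, ← pow_add]
    exact Nat.pow_le_pow_right (by norm_num) (by omega)
  have h2Bℓ : 2 ^ (2 * B) ≤ ℓ := by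
    rw [hℓ]
    exact Nat.pow_le_pow_right (by norm_num) (by omega)
  have hBx : 2 ^ (B + 1) ≤ x := by
    rw [hx]
    exact Nat.pow_le_pow_right (by norm_num) (by omega)
  -- the primes
  set P : Finset ℕ := (Finset.Ioc (2 ^ A) (2 ^ B)).filter Nat.Prime with hPdef
  have hPmem : ∀ p ∈ P, 2 ^ A < p ∧ p ≤ 2 ^ B ∧ p.Prime := fun p hp => by
    simp only [hPdef, Finset.mem_filter, Finset.mem_Ioc] at hp
    exact ⟨hp.1.1, hp.1.2, hp.2⟩
  have hP : ∀ p ∈ P, p.Prime := fun p hp => (hPmem p hp).2.2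
  have hP1 : ∀ p ∈ P, 1 ≤ p := fun p hp => (hP p hp).one_lt.le
  have hP1B : ∀ p ∈ P, 1 ≤ p ∧ p ≤ 2 ^ B := fun p hp => ⟨hP1 p hp, (hPmem p hp).2.1⟩
  have hPcard : P.card ≤ 2 ^ B := by
    calc P.card ≤ (Finset.Ioc (2 ^ A) (2 ^ B)).card := Finset.card_filter_le _ _
      _ = 2 ^ B - 2 ^ A := Nat.card_Ioc _ _
      _ ≤ 2 ^ B := Nat.sub_le _ _
  -- the block map
  obtain ⟨V, hV⟩ := exists_binaryRound s
  have hVle : ∀ p ∈ P, p ≤ V p := fun p hp => (hV p (hP1 p hp)).1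
  have hVlog : ∀ p ∈ P, V p ≤ 2 ^ (B + 1) := by
    intro p hp
    refine (hV p (hP1 p hp)).2.2.2.2.trans (Nat.pow_le_pow_right (by norm_num) ?_)
    have h := Nat.log_mono_right (b := 2) (hPmem p hp).2.1
    rw [Nat.log_pow (by norm_num)] at h
    omega
  have hVx : ∀ p ∈ P, V p ≤ x := fun p hp => (hVlog p hp).trans hBx
  have hVℓ : ∀ p ∈ P, x * V p ≤ x * p + ℓ * V p := by
    intro p hp
    have h := (hV p (hP1 p hp)).2.2.2.1
    have h' := hVle p hp
    rw [hxℓ]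
    calc 2 ^ s * ℓ * V p = ℓ * (2 ^ s * V p) := by ring
      _ ≤ ℓ * (2 ^ s * p + p) := Nat.mul_le_mul_left _ h
      _ ≤ ℓ * (2 ^ s * p + V p) := Nat.mul_le_mul_left _ (by omega)
      _ = 2 ^ s * ℓ * p + ℓ * V p := by ring
  obtain ⟨hmono, hceil⟩ := binaryRound_mono_ceiling s V hV P hP1
  -- the prime-sum input at level `k`
  have hA0 : (0 : ℝ) < A := by exact_mod_cast (show 0 < A by omega)
  obtain ⟨η', hη'⟩ : ∃ η' : ℝ, η' = η / (A * Real.log 2) := ⟨_, rfl⟩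
  have hη'0 : 0 < η' := by rw [hη']; positivity
  have hcum : ∀ ψ : DirichletCharacter ℂ (2 ^ k), ψ ≠ 1 → ∀ u : ℕ, 2 ^ A ≤ u →
      ‖∑ p ∈ (Finset.Iic u).filter Nat.Prime, ψ (p : ZMod (2 ^ k))‖ ≤ η' * u := by
    intro ψ hψ u hu
    have h := hk₁ k hk₁k ψ hψ A hθA u hu
    refine h.trans ?_
    have hu0 : (0 : ℝ) < u := by
      have : (1 : ℝ) ≤ 2 ^ A := one_le_pow₀ (by norm_num)
      exact_mod_cast lt_of_lt_of_le (Nat.one_le_two_pow) hu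
    have hlogu : (A : ℝ) * Real.log 2 ≤ Real.log u := by
      rw [← Real.log_pow]
      exact Real.log_le_log (by positivity) (by exact_mod_cast hu)
    have h1 : η * u / Real.log u ≤ η * u / (A * Real.log 2) :=
      div_le_div_of_nonneg_left (by positivity) (by positivity) hlogu
    refine h1.trans (le_of_eq ?_)
    rw [hη']
    ring
  -- the block bounds
  obtain ⟨β, hβdef⟩ : ∃ β : ℕ → ℝ, ∀ v : ℕ, β v = 4 * (η' * v) := ⟨_, fun v => rfl⟩
  have hβ0 : ∀ v, 0 ≤ β v := fun v => by
    rw [hβdef]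
    exact mul_nonneg (by norm_num) (mul_nonneg hη'0.le (Nat.cast_nonneg v))
  have hβ : ∀ ψ : DirichletCharacter ℂ (2 ^ k), ψ ≠ 1 → ∀ v ∈ P.image V,
      ‖∑ p ∈ P.filter (fun p => V p = v), ψ (p : ZMod (2 ^ k))‖ ≤ β v := by
    intro ψ hψ v hv
    have hav : 2 ^ A ≤ v := by
      obtain ⟨p, hp, rfl⟩ := Finset.mem_image.mp hv
      exact ((hPmem p hp).1.le).trans (hVle p hp)
    have h := norm_sum_fibre_le_of_primeSums (2 ^ A) (2 ^ B) (Nat.pow_le_pow_right (by norm_num) hAB) V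
      hmono hVle v hav (hceil v hv) (fun p => ψ (p : ZMod (2 ^ k))) (fun u => η' * u)
      (fun a b hab => mul_le_mul_of_nonneg_left (by exact_mod_cast hab) hη'0.le) (hcum ψ hψ)
    rw [hβdef]
    exact h
  -- THE BILINEAR INEQUALITY
  have hmain := charSqSum_mul_sq_le_of_blockBounds' (q := 2 ^ k) x ℓ hℓx P hP V hVle hVx hVℓ β hβ0 hβ
  ------------------------------------------------------------------------------------------------
  -- numerics
  have hX : (x : ℝ) = 2 ^ (n + k) := by rw [hx]; push_cast; ring
  -- Mertens: `L ≥ r log 2 − 1`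
  have hL1 : (48 / ε + 1 : ℝ) ≤ ∑ p ∈ P, (1 : ℝ) / p := by
    have hM := sum_inv_prime_dyadic_ge A r hA9
    have hPL : ∑ p ∈ (Finset.Ioc (2 ^ A) (2 ^ (2 ^ r * A))).filter Nat.Prime, (1 : ℝ) / p =
        ∑ p ∈ P, (1 : ℝ) / p := rfl
    linarith
  have hvals := card_image_binaryRound_le s B V hV P hP1B
  clear_value P x ℓ A B
  obtain ⟨L, hL⟩ : ∃ L : ℝ, L = ∑ p ∈ P, (1 : ℝ) / p := ⟨_, rfl⟩
  obtain ⟨R, hR⟩ : ∃ R : ℝ, R = ∑ v ∈ P.image V, β v / v := ⟨_, rfl⟩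
  obtain ⟨R', hR'⟩ : ∃ R' : ℝ, R' = ∑ v ∈ P.image V, β v := ⟨_, rfl⟩
  rw [← hL, ← hR, ← hR'] at hmain
  rw [← hL] at hL1
  have hX0 : (0 : ℝ) < x := by rw [hX]; positivity
  have hL48 : 48 / ε ≤ L := by linarith
  have hLone : 1 ≤ L := by
    have : 0 < 48 / ε := by positivity
    linarith
  have hεL : 48 ≤ ε * L := by
    have := (div_le_iff₀' hε).mp hL48
    linarith
  -- `R = 4 η' #values ≤ ε / 8`
  have hv1 : ∀ v ∈ P.image V, (1 : ℝ) ≤ v := by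
    intro v hv
    obtain ⟨p, hp, rfl⟩ := Finset.mem_image.mp hv
    exact_mod_cast (hP1 p hp).trans (hVle p hp)
  have hReq : R = 4 * η' * (P.image V).card := by
    rw [hR]
    have : ∀ v ∈ P.image V, β v / v = 4 * η' := by
      intro v hv
      have hv0 : (v : ℝ) ≠ 0 := by have := hv1 v hv; positivity
      rw [hβdef]
      field_simp
    rw [Finset.sum_congr rfl this, Finset.sum_const, nsmul_eq_mul]
    ring
  have hRle : R ≤ ε / 8 := by
    rw [hReq, hη']
    have hc : ((P.image V).card : ℝ) ≤ (B + 2) * 2 ^ (s + 1) := by exact_mod_cast hvals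
    have hB2 : ((B : ℝ) + 2) ≤ (2 ^ r + 1) * A := by
      have : (B : ℝ) = 2 ^ r * A := by rw [hB]; push_cast; ring
      have h2 : (2 : ℝ) ≤ A := by exact_mod_cast (show 2 ≤ A by omega)
      rw [this]
      linarith
    rw [hη]
    have hlog2' : Real.log 2 ≠ 0 := hlog2.ne'
    calc 4 * (ε * Real.log 2 / (64 * (2 ^ r + 1) * 2 ^ s) / (A * Real.log 2)) * ((P.image V).card : ℝ)
        ≤ 4 * (ε * Real.log 2 / (64 * (2 ^ r + 1) * 2 ^ s) / (A * Real.log 2)) * ((B + 2) * 2 ^ (s + 1)) := by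
          gcongr
      _ ≤ 4 * (ε * Real.log 2 / (64 * (2 ^ r + 1) * 2 ^ s) / (A * Real.log 2)) * ((2 ^ r + 1) * A * 2 ^ (s + 1)) := by
          gcongr
      _ = ε / 8 := by
          field_simp
          ring
  have hRL : R ≤ ε / 8 * L := hRle.trans (by
    have : ε / 8 * 1 ≤ ε / 8 * L := mul_le_mul_of_nonneg_left hLone (by positivity)
    linarith)
  have hR0 : 0 ≤ R := by
    rw [hReq]
    exact mul_nonneg (mul_nonneg (by norm_num) hη'0.le) (Nat.cast_nonneg _)
  -- `R' ≤ 2^(B+1) R`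
  have hR'le : R' ≤ 2 ^ (B + 1) * R := by
    rw [hR', hReq]
    have : ∀ v ∈ P.image V, β v ≤ 4 * η' * 2 ^ (B + 1) := by
      intro v hv
      obtain ⟨p, hp, rfl⟩ := Finset.mem_image.mp hv
      have h1 : ((V p : ℕ) : ℝ) ≤ 2 ^ (B + 1) := by exact_mod_cast hVlog p hp
      rw [hβdef, ← mul_assoc]
      exact mul_le_mul_of_nonneg_left h1 (mul_nonneg (by norm_num) hη'0.le)
    calc ∑ v ∈ P.image V, β v ≤ ∑ v ∈ P.image V, 4 * η' * 2 ^ (B + 1) := Finset.sum_le_sum this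
      _ = 2 ^ (B + 1) * (4 * η' * ((P.image V).card : ℝ)) := by
          rw [Finset.sum_const, nsmul_eq_mul]; ring
  have hR'0 : 0 ≤ R' := by rw [hR']; exact Finset.sum_nonneg fun v _ => hβ0 v
  -- casts of the size facts
  have cq : (((2 ^ k : ℕ) : ℝ)) = 2 ^ k := by push_cast; ring
  have cℓs : (x : ℝ) = 2 ^ s * ℓ := by exact_mod_cast hxℓ
  have c2q : 2 * (2 : ℝ) ^ k ≤ ℓ := by exact_mod_cast h2qℓ
  have cqB : (2 : ℝ) ^ k * 2 ^ (B + 2) ≤ x := by exact_mod_cast hqB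
  have cPB : (P.card : ℝ) ≤ 2 ^ B := by exact_mod_cast hPcard
  have c2B : (2 : ℝ) ^ (2 * B) ≤ ℓ := by exact_mod_cast h2Bℓ
  have cP2 : (P.card : ℝ) ^ 2 ≤ ℓ := by
    calc (P.card : ℝ) ^ 2 ≤ (2 ^ B) ^ 2 := pow_le_pow_left₀ (Nat.cast_nonneg _) cPB 2
      _ = 2 ^ (2 * B) := by rw [← pow_mul, mul_comm]
      _ ≤ ℓ := c2B
  have cℓ0 : (0 : ℝ) ≤ ℓ := Nat.cast_nonneg _
  have cq0 : (0 : ℝ) ≤ 2 ^ k := by positivity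
  have cℓX : (ℓ : ℝ) ≤ x := by exact_mod_cast hℓx
  have c4s : (4 : ℝ) ^ s = (2 ^ s) ^ 2 := by rw [← pow_mul, mul_comm, pow_mul]; norm_num
  -- total
  have hPx : (P.card : ℝ) ^ 2 + 2 * L * P.card ≤ x * L := by
    have h3 : 3 * (2 : ℝ) ^ (2 * B) ≤ x := by
      calc 3 * (2 : ℝ) ^ (2 * B) ≤ 4 * 2 ^ (2 * B) := by gcongr; norm_num
        _ = 2 ^ (2 * B + 2) := by rw [pow_add]; ring
        _ ≤ 2 ^ k * 2 ^ (B + 2) := by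
            rw [← pow_add]
            exact pow_le_pow_right₀ (by norm_num) (by omega)
        _ ≤ x := cqB
    have h22 : (P.card : ℝ) ^ 2 ≤ 2 ^ (2 * B) := by
      calc (P.card : ℝ) ^ 2 ≤ (2 ^ B) ^ 2 := pow_le_pow_left₀ (Nat.cast_nonneg _) cPB 2
        _ = 2 ^ (2 * B) := by rw [← pow_mul, mul_comm]
    have hP0 : (0 : ℝ) ≤ P.card := Nat.cast_nonneg _
    have hPB' : (P.card : ℝ) * L ≤ 2 ^ (2 * B) * L := by
      have : (P.card : ℝ) ≤ 2 ^ (2 * B) := cPB.trans (by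
        calc (2 : ℝ) ^ B = 2 ^ B * 1 := by ring
          _ ≤ 2 ^ B * 2 ^ B := by gcongr; exact one_le_pow₀ (by norm_num)
          _ = 2 ^ (2 * B) := by rw [← pow_add, two_mul])
      exact mul_le_mul_of_nonneg_right this (by linarith)
    have e1 : (2 : ℝ) ^ (2 * B) ≤ 2 ^ (2 * B) * L := le_mul_of_one_le_right (by positivity) hLone
    have e2 : 3 * (2 : ℝ) ^ (2 * B) * L ≤ x * L := mul_le_mul_of_nonneg_right h3 (by linarith)
    linarith [h22, hPB', e1, e2]
  have hℓx2 : 72 * (ℓ : ℝ) ^ 2 ≤ ε * (x : ℝ) ^ 2 := by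
    have h3 : (ℓ : ℝ) ^ 2 * 4 ^ s = (x : ℝ) ^ 2 := by rw [cℓs, c4s]; ring
    have h4 : (72 : ℝ) ≤ ε * 4 ^ s := by
      have := (div_le_iff₀' hε).mp hs.le
      linarith
    have h5 : 72 * (ℓ : ℝ) ^ 2 ≤ (ε * 4 ^ s) * (ℓ : ℝ) ^ 2 := mul_le_mul_of_nonneg_right h4 (sq_nonneg _)
    calc 72 * (ℓ : ℝ) ^ 2 ≤ (ε * 4 ^ s) * (ℓ : ℝ) ^ 2 := h5
      _ = ε * ((ℓ : ℝ) ^ 2 * 4 ^ s) := by ring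
      _ = ε * (x : ℝ) ^ 2 := by rw [h3]
  have hqR' : 2 * (2 : ℝ) ^ k * R' ≤ x * R := by
    calc 2 * (2 : ℝ) ^ k * R' ≤ 2 * 2 ^ k * (2 ^ (B + 1) * R) := by gcongr
      _ = (2 ^ k * 2 ^ (B + 2)) * R := by ring
      _ ≤ x * R := by gcongr
  have hqx : 2 * (2 : ℝ) ^ k ≤ x := c2q.trans cℓX
  have htot : L ^ 2 * ∑ ψ ∈ (Finset.univ : Finset (DirichletCharacter ℂ (2 ^ k))).erase 1,
      ‖∑ m ∈ Finset.Icc 1 x, (liouville m : ℂ) * ψ (m : ZMod (2 ^ k))‖ ^ 2 ≤ L ^ 2 * (ε * (x : ℝ) ^ 2) := by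
    rw [cq] at hmain
    exact hmain.trans (bilinear_rhs_le (x : ℝ) ((2 : ℝ) ^ k) ℓ L R R' P.card ε hε hε1 hX0 cq0 cℓ0
      (Nat.cast_nonneg _) hLone hεL hR0 hRL hR'0 hqR' c2q cP2 hℓx2 hPx hqx)
  have hL2 : 0 < L ^ 2 := by positivity
  have hfin : ∑ ψ ∈ (Finset.univ : Finset (DirichletCharacter ℂ (2 ^ k))).erase 1,
      ‖∑ m ∈ Finset.Icc 1 x, (liouville m : ℂ) * ψ (m : ZMod (2 ^ k))‖ ^ 2 ≤ ε * (x : ℝ) ^ 2 :=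
    le_of_mul_le_mul_left htot hL2
  -- back to the line's currency
  have hsum : ∀ ψ : DirichletCharacter ℂ (2 ^ k),
      (∑ m : Fin x, ((liouville ((m : ℕ) + 1) : ℤ) : ℂ) * ψ (((m : ℕ) + 1 : ℕ) : ZMod (2 ^ k))) =
        ∑ m ∈ Finset.Icc 1 x, (liouville m : ℂ) * ψ (m : ZMod (2 ^ k)) := fun ψ => by
    rw [hx]
    exact sum_fin_succ_eq_sum_Icc (fun m => (liouville m : ℂ) * ψ (m : ZMod (2 ^ k))) (2 ^ (n + k))
  have hgoal : (∑ ψ ∈ (Finset.univ : Finset (DirichletCharacter ℂ (2 ^ k))).erase 1,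
      ‖∑ m : Fin x, ((liouville ((m : ℕ) + 1) : ℤ) : ℂ) * ψ (((m : ℕ) + 1 : ℕ) : ZMod (2 ^ k))‖ ^ 2) =
      ∑ ψ ∈ (Finset.univ : Finset (DirichletCharacter ℂ (2 ^ k))).erase 1,
        ‖∑ m ∈ Finset.Icc 1 x, (liouville m : ℂ) * ψ (m : ZMod (2 ^ k))‖ ^ 2 :=
    Finset.sum_congr rfl fun ψ _ => by rw [hsum ψ]
  refine hgoal.trans_le (hfin.trans ?_)
  have h4 : (4 : ℝ) ^ (n + k) = (x : ℝ) ^ 2 := by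
    rw [hX, ← pow_mul, mul_comm, pow_mul]
    norm_num
  rw [h4]
  exact mul_le_mul_of_nonneg_right hεε₀ (sq_nonneg _)


/-- **`AlignedTypeI` from prime character sums to `2`-power moduli** (CONDITIONAL on (PCS), see the module docstring):
the leaf `Σ_{a<2^n} |Σ_{b<2^n} λ(a + 2^n b + 1)| = o(4^n)` follows from the `o(1)`-saving of `Σ_{p ≤ u} ψ(p)` for
non-principal `ψ (mod 2^k)` at every length `u ≥ 2^{θk}` (Banks–Shparlinski 2019 Thm 2.2 / Gallagher 1972), via
`charMeanSquare_of_primeCharSums` and `alignedTypeI_of_charMeanSquare`. [folklore] -/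
theorem alignedTypeI_of_primeCharSums
    (hPCS : ∀ θ : ℝ, 0 < θ → ∀ η : ℝ, 0 < η → ∃ k₁ : ℕ, ∀ k : ℕ, k₁ ≤ k →
      ∀ ψ : DirichletCharacter ℂ (2 ^ k), ψ ≠ 1 → ∀ a : ℕ, θ * k ≤ a → ∀ u : ℕ, 2 ^ a ≤ u →
        ‖∑ p ∈ (Finset.Iic u).filter Nat.Prime, ψ (p : ZMod (2 ^ k))‖ ≤ η * u / Real.log u) :
    Summit.ValiantsHypothesis.ValiantsHypothesis.Theses.LiouvilleSarnak.AlignedTypeI :=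
  alignedTypeI_of_charMeanSquare (charMeanSquare_of_primeCharSums hPCS)

end Summit.ValiantsHypothesis.ValiantsHypothesis.Theorems.LiouvilleSarnak.AlignedTypeI.CharactersModTwoN
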